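import Summits.QuantumFields.YangMills.Theorems.BalabanUVNodesK2NamedJetsRunRemAt

/-!
# IDEA-4 g13 (items lens, fourth angle) — row (C) of K1⁸ is PER-LEVEL SOFT ANALYSIS once a thermodynamic limit with a rate is on the table

Crux-ideation kernel sketch for `stmt-QuantumFields-20543` (`EndpointGivenBR13SepCoPH`, now `aside`), bearing on the NEWBORN deciding crux
K1⁸ `Theses.BalabanUVNodes.StabilityBRunRowsAtRecordR13SepCoPH` (`stmt-QuantumFields-26907`, rev 27), row (C) = the run-wise survivor continuity
`SurvCont β_θ γ₀` asked by `stub_cont13` of skeleton «v7ᴿ» ed.2′.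

WHAT THIS FILE CERTIFIES (0 `sorry`, generic over `FlowStep.HBeta`; nothing of Bałaban asserted):
* `ThermoRate` — idea-1's HYP B text (`Cruxes/EndpointGivenBR13SepCoPH/ApproximantLaplaceSketch.lean` :88, body VERBATIM): the depth-`r`
  finite-volume β's `βf r` are within `τ r` of `β` on every history box `]0, γ̄]^{k+1}`.
* `PerLevelLimit` — the WEAKER, per-scale text row (C) actually consumes: for each `k` separately, SOME null sequence `τₖ` with the same bound.
* `FinContEv` — the one NEW soft letter: for each `k`, the finite-volume `βf r k` are EVENTUALLY (in `r`) continuous on the box — a statement about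
  finitely many finite-dimensional integrals (`Node00.polWindow` at a fixed torus), the (i)-half of the N26 desk's `n26lit_betaOfTerms_of_finiteVolume`
  (`Theorems/BalabanUVNodesN26BetaContRecord.lean` §5) read in idea-1's MOMENT currency instead of N26's SITEWISE currency.
* T1–T4: `ThermoRate ∧ τ → 0` (or just `PerLevelLimit`) `∧ FinContEv ⟹ BetaContH γ̄ β ⟹ SurvCont β γ₀` for every `0 < γ₀ ≤ γ̄`, the last line in the
  VERBATIM shape of K1⁸'s row (C) (`Mathlib`'s `TendstoUniformlyOn.continuousOn` + the tree's `FlowStep.histBox_eq_box`, `FlowStep.box_mono`,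
  `K2NamedJetsRunRemAt.SurvCont.of_betaContH` BY NAME).
* T5: `ThermoRate β (fun _ => β) 0 γ̄` holds for EVERY `β` — the rate letter alone carries no continuity; the content of (C) on this road is exactly
  `FinContEv` (finite volume) + the EXISTENCE of a per-level uniform limit (locality ∕ (1.21) class), and NOTHING k-uniform.

PRIOR ART IN THE TREE (this file is a VARIANT, claimed as nothing more): the sitewise road (C-fin) + (VR-u) ⟹ (C-pt) ⟹ (C) is LANDED Literature
`…Balaban1983to89.Beta.BetaContinuityVolume` (b2b-balaban BETA-an4: `continuousOn_of_uniform_rate`, `betaContH_of_kernel_volumeRate`,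
`betaContH_of_chain_volumeRate`) and, at the record's objects, `Theorems/BalabanUVNodesN26BetaContRecord` §4∕§5; IDEA-2 g16's census
`Cruxes/StabilityBAtRecordR13SepCoPH/DECOMP-K1R8-idea2-g16.md` §1 tables it.  T1–T2 below are the MOMENT-currency twin (acting on `β` and on idea-1's
`ThermoRate` text directly, no kernel entries, no decay needed at this step); the file exists to make memo nit (n2) checkable against idea-1's text shape.

CONSEQUENCE FOR THE ITEMS (memo `REV27-K1R8-ROWMAP-idea4-g13.md` ed.2 §3): on idea-1's line `FinLaplace13K → VolConv13K → UnifDecay13K → SurvCont13K → K2`,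
TEXT C `SurvCont13K` is IMPLIED by TEXT B-i∕B-ii (which give `ThermoRate13` with `τ → 0`, `thermoRate_of_volConv_unifDecay` :557) plus a `FinContEv`
text for `betaFin F θ`; and row (C) of K1⁸, priced per level, has its cheapest known supplier road in the tree BY NAME (N26 §4∕§5 sitewise; this file
moment-wise) — its open content is finite-volume regularity + per-level thermodynamic convergence, not a k-uniform estimate and not the AF sign.

HONEST FRAMING: a kernel-checked composition of named soft-analysis facts; no stub of any registered skeleton is proved; no node of the closability DAG is
discharged; `ThermoRate`∕`PerLevelLimit`∕`FinContEv` at the record's `betaFin` are OBLIGATION TEXTS, unperformed in print for Bałaban's own expansions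
([I] (1.21) p. 264 asserts the limit exists by locality + (5.10), no rate, no continuity statement).  Route `BalabanUVNodes` closes the CONDITIONAL
finite-𝕋⁴ rung R4 `BalabanLadder.UV` only — NOT `Summit.QuantumFields.YangMills`, nothing continuum ∕ OS ∕ mass gap; the Clay problem is NOT proved
by any of this.

[cite: Balaban1987RG1, (1.21)–(1.22) p. 264 and (5.10) p. 293; §1 pp. 263–264 (continuity in the coupling used without proof)]
-/

noncomputable section

namespace Summit.QuantumFields.YangMills.Cruxes.EndpointGivenBR13SepCoPH.Idea4g13

open Filter Topology
open Literature.MathematicalPhysics.QuantumFieldTheory.Balaban1983to89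
open Literature.MathematicalPhysics.QuantumFieldTheory.Balaban1983to89.FlowStep
open Literature.MathematicalPhysics.QuantumFieldTheory.Balaban1983to89.B12Beta (HistBox)
open Summit.QuantumFields.YangMills.Theorems.BalabanUVNodesK2NamedJetsRunRemAt

variable {β : HBeta} {βf : ℕ → HBeta} {τ : ℕ → ℝ} {γbar γ₀ : ℝ}

/-! ## §1 The three letters -/

/-- HYP B shape of idea-1 (`ApproximantLaplaceSketch.ThermoRate`, body VERBATIM): **k-UNIFORM THERMODYNAMIC RATE** — the depth-`r` finite-volume β is
within `τ r` of `β` on the box `]0, γ̄]^{k+1}`, for every scale `k`.  A predicate, never a fact. [cite: Balaban1987RG1, (1.21) p. 264] -/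
def ThermoRate (β : HBeta) (βf : ℕ → HBeta) (τ : ℕ → ℝ) (γbar : ℝ) : Prop :=
  ∀ (r k : ℕ) (v : Fin (k + 1) → ℝ), v ∈ HistBox γbar k → |βf r k v - β k v| ≤ τ r

/-- **PER-LEVEL UNIFORM LIMIT** — the weaker text row (C) consumes: for each scale `k` SEPARATELY, some null sequence `τₖ` bounds `|βf r k − β k|` on the
box.  No uniformity in `k`.  A predicate, never a fact. [cite: Balaban1987RG1, (1.21) p. 264] -/
def PerLevelLimit (β : HBeta) (βf : ℕ → HBeta) (γbar : ℝ) : Prop :=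
  ∀ k : ℕ, ∃ τ : ℕ → ℝ, Tendsto τ atTop (𝓝 0) ∧ ∀ (r : ℕ) (v : Fin (k + 1) → ℝ), v ∈ HistBox γbar k → |βf r k v - β k v| ≤ τ r

/-- **EVENTUAL FINITE-VOLUME CONTINUITY** — for each scale `k`, the depth-`r` finite-volume β is continuous on the box for all large `r` (finitely many
finite-dimensional integrals per `(r, k)`).  A predicate, never a fact; the (i)-half of N26's `n26lit_betaOfTerms_of_finiteVolume` in moment currency.
[cite: Balaban1987RG1, (1.18)–(1.22) pp. 263–264] -/
def FinContEv (βf : ℕ → HBeta) (γbar : ℝ) : Prop :=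
  ∀ k : ℕ, ∀ᶠ r in atTop, ContinuousOn (βf r k) (HistBox γbar k)

/-- All-depth continuity gives the eventual letter. [folklore] -/
theorem finContEv_of_forall (h : ∀ r k, ContinuousOn (βf r k) (HistBox γbar k)) : FinContEv βf γbar :=
  fun k => Eventually.of_forall fun r => h r k

/-- A k-uniform rate with `τ → 0` gives the per-level limit (the converse fails in general). [folklore] -/
theorem perLevelLimit_of_thermoRate (hT : ThermoRate β βf τ γbar) (hτ : Tendsto τ atTop (𝓝 0)) : PerLevelLimit β βf γbar :=
  fun k => ⟨τ, hτ, fun r v hv => hT r k v hv⟩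

/-! ## §2 T1–T4: limit letter + finite-volume continuity ⟹ (C) on the boxes ⟹ run-wise (C) -/

/-- T1 — a per-level null-rate bound is uniform convergence on the box. [folklore] -/
theorem tendstoUniformlyOn_of_rate {k : ℕ} {τ : ℕ → ℝ} (hτ : Tendsto τ atTop (𝓝 0))
    (h : ∀ (r : ℕ) (v : Fin (k + 1) → ℝ), v ∈ HistBox γbar k → |βf r k v - β k v| ≤ τ r) :
    TendstoUniformlyOn (fun r => βf r k) (β k) atTop (HistBox γbar k) := by
  rw [Metric.tendstoUniformlyOn_iff]
  intro ε hε
  filter_upwards [hτ.eventually (gt_mem_nhds hε)] with r hr v hv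
  rw [Real.dist_eq, abs_sub_comm]
  exact (h r v hv).trans_lt hr

/-- T1′ — in particular from idea-1's `ThermoRate` with `τ → 0`. [folklore] -/
theorem tendstoUniformlyOn_of_thermoRate (hT : ThermoRate β βf τ γbar) (hτ : Tendsto τ atTop (𝓝 0)) (k : ℕ) :
    TendstoUniformlyOn (fun r => βf r k) (β k) atTop (HistBox γbar k) :=
  tendstoUniformlyOn_of_rate hτ fun r v hv => hT r k v hv

/-- T2 — **(C) ON THE BOXES from the per-level limit + eventual finite-volume continuity**: a uniform limit of eventually-continuous functions is
continuous (`TendstoUniformlyOn.continuousOn`), box by box; `HistBox = Box` (`FlowStep.histBox_eq_box`). [folklore] -/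
theorem betaContH_of_perLevelLimit_finContEv (hL : PerLevelLimit β βf γbar) (hC : FinContEv βf γbar) : BetaContH γbar β := by
  intro k
  obtain ⟨τ, hτ, h⟩ := hL k
  rw [← histBox_eq_box]
  exact (tendstoUniformlyOn_of_rate hτ h).continuousOn (hC k).frequently

/-- T2′ — the same from idea-1's `ThermoRate` with `τ → 0`. [folklore] -/
theorem betaContH_of_thermoRate_finContEv (hT : ThermoRate β βf τ γbar) (hτ : Tendsto τ atTop (𝓝 0)) (hC : FinContEv βf γbar) :
    BetaContH γbar β :=
  betaContH_of_perLevelLimit_finContEv (perLevelLimit_of_thermoRate hT hτ) hC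

/-- (C) on the boxes restricts to smaller boxes (`FlowStep.box_mono`). [folklore] -/
theorem betaContH_of_le (hle : γ₀ ≤ γbar) (h : BetaContH γbar β) : BetaContH γ₀ β :=
  fun k => (h k).mono (box_mono hle k)

/-- T3 — **RUN-WISE (C) at every level `0 < γ₀ ≤ γ̄`** (`K2NamedJetsRunRemAt.SurvCont.of_betaContH` BY NAME). [folklore] -/
theorem survCont_of_perLevelLimit_finContEv (hL : PerLevelLimit β βf γbar) (hC : FinContEv βf γbar) (hγ₀ : 0 < γ₀) (hle : γ₀ ≤ γbar) :
    SurvCont β γ₀ :=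
  SurvCont.of_betaContH hγ₀ (betaContH_of_le hle (betaContH_of_perLevelLimit_finContEv hL hC))

/-- T3′ — the same from idea-1's `ThermoRate` with `τ → 0`: on idea-1's line, TEXT C (`SurvCont13K`) is implied by TEXT B (rate) + a finite-volume
continuity text. [folklore] -/
theorem survCont_of_thermoRate_finContEv (hT : ThermoRate β βf τ γbar) (hτ : Tendsto τ atTop (𝓝 0)) (hC : FinContEv βf γbar)
    (hγ₀ : 0 < γ₀) (hle : γ₀ ≤ γbar) : SurvCont β γ₀ :=
  survCont_of_perLevelLimit_finContEv (perLevelLimit_of_thermoRate hT hτ) hC hγ₀ hle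

/-- T4 — **ROW (C) OF K1⁸, VERBATIM SHAPE** (`∀ k, ContinuousOn (fun x => β k (clampPrefix β γ₀ k x)) {x | 0 < x ∧ x ≤ γ₀ ∧ ∀ j ≤ k, 1/γ₀² ≤ Y β γ₀ j x}`)
at any history-indexed `β` — in the route, `β := Node00.betaOfRecord₁₃ F 2 θ.toStage13Params` — from the per-level limit letter + eventual finite-volume
continuity on a box `]0, γ̄]` containing the rows' window level `γ₀`. [folklore] -/
theorem rowC_of_perLevelLimit_finContEv (hL : PerLevelLimit β βf γbar) (hC : FinContEv βf γbar) (hγ₀ : 0 < γ₀) (hle : γ₀ ≤ γbar) :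
    ∀ k : ℕ, ContinuousOn (fun x : ℝ => β k (clampPrefix β γ₀ k x))
      {x : ℝ | 0 < x ∧ x ≤ γ₀ ∧ ∀ j, j ≤ k → 1 / γ₀ ^ 2 ≤ Y β γ₀ j x} :=
  survCont_of_perLevelLimit_finContEv hL hC hγ₀ hle

/-! ## §3 T5: where the content sits -/

/-- T5 — the rate letter ALONE is contentless for continuity: every `β` is its own depth-`r` approximant with rate `0`.  So on this road ALL of (C)'s
content is `FinContEv` (finite volume) + the fact that the limit in `PerLevelLimit` is the record's `β` ((1.21)-class locality), per level. [folklore] -/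
theorem thermoRate_self (β : HBeta) (γbar : ℝ) : ThermoRate β (fun _ => β) (fun _ => 0) γbar := by
  intro r k v _
  simp

/-- T5′ — and `FinContEv` for the constant approximant `fun _ => β` IS `BetaContH` (nothing gained without a genuinely finite-volume `βf`). [folklore] -/
theorem finContEv_self_iff (β : HBeta) (γbar : ℝ) : FinContEv (fun _ => β) γbar ↔ BetaContH γbar β := by
  constructor
  · intro h k
    rw [← histBox_eq_box]
    obtain ⟨r, hr⟩ := (h k).exists
    exact hr
  · intro h k
    exact Eventually.of_forall fun _ => (histBox_eq_box γbar k).symm ▸ h k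

end Summit.QuantumFields.YangMills.Cruxes.EndpointGivenBR13SepCoPH.Idea4g13

end
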